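/-
Copyright: pub-rosobs cell (Resolution Observatory), carver gen 40.  Companion file; statements OURS, in
the cell's polynomial weighted-centre model `W(f)`.  Instrument — NOT a resolution theorem.
-/
import Literature.AlgebraicGeometry.Resolution.WeightedCentreUmbrellaCubeMax
import HarnessLib

/-!
# `max W(v² + w^m u + y z) = (2, 2, 2, m+1, m+1)` — an umbrella behind a rank-three quadratic apex

For `f = X_i² + X_j^m X_l + X_{e₁} X_{e₂}` (`i, j, l, e₁, e₂` distinct indices among `N`, any number of
spectator variables, `m ≥ 2`, ALL polynomial coordinate changes `Ψ`) we prove, in the cell's polynomial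
model `W(f) = {exps γ : (Ψ, γ) an admissible centre for f}` of [AbramovichTemkinWlodarczyk2024, Thm. 5.3.1 (2)]:

* `(2, 2, 2, m+1, m+1) ∈ W(f)` (the coordinate centre `(X_i², X_{e₁}², X_{e₂}², X_j^{m+1}, X_l^{m+1})`);
* `τ(in₂ f) = τ(X_i² + X_{e₁} X_{e₂}) = 3` in EVERY characteristic (`hironakaTau_sq_add_mul`), hence the
  first block: nothing in `W(f)` is above `(2, 2, 2)` (`replicate_prefix_of_forall_le` of
  `WeightedCentreInvariantSet`);
* **second vertex** (`not_isCentreFor_umbrellaQuad_vertex`, weight form; `not_isCentreFor_umbrellaQuad_of_exps`,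
  invariant form): no centre has three weights `1/2`, one weight `γ_d ≤ 1/(m+1)` on a fourth variable and all
  other weights `≤ q/p` with `(m+1) q < p` — equivalently no invariant `(2, 2, 2, t…)` with
  `(m+1, m+1) <_trunc t` — provided `2 ≠ 0` in `k` or `m` is even;
* hence **`IsMaxInv W(f) (2, 2, 2, m+1, m+1)`** (`isMaxInv_umbrellaQuad`); for the census shape
  `v² + w⁴ u + y z` (`m = 4`, shape `U22ZZ` of the observatory's normal-form census) this holds in EVERY
  characteristic (`isMaxInv_umbrellaQuad_four`).

Method (second vertex) — the restriction-and-slices method of `WeightedCentreUmbrellaCubeMax`, now with a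
three-dimensional apex.  Let `κ` kill the three weight-`1/2` variables and `ρ = κ ∘ Ψ⁻¹`.  The Taylor maps
`X_x ↦ ρ(X_x) + ε ρ(ξ_x)` (`fieldTaylorₐ`) along the three coordinate fields `∂_i, ∂_{e₁}, ∂_{e₂}` send
`f = Ψ(Ψ⁻¹ f)` to polynomials whose `ε^j`-slices have large weighted order (`SliceOrd`, transfer
`SliceOrd.map`) for the integer weights `6p` on `X_d`, `6(m+1)q` elsewhere (`heavyWeights`); the `ε¹`-slices
give the orders of `ρ(X_i)` (in characteristic `≠ 2`), `ρ(X_{e₁})`, `ρ(X_{e₂})`, and reading the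
`ε⁰`-slice in the degree grading (`homogeneousComponent_of_le_monomialOrd_heavyWeights`) gives
`lin ρ(X_i) = lin ρ(X_{e₁}) = lin ρ(X_{e₂}) = 0` and `(lin ρ X_j)^m · lin ρ(X_l) = κ' X_d^{m+1}`;
`linForm_trichotomy` and the rank of the Jacobian of `Ψ⁻¹` at the origin (`false_of_jacobian_rows_supported`:
five rows on four columns) finish the proof.  No tangent vector field and no apex lemma are needed here; in
characteristic `2` the order of `ρ(X_i)` is replaced by the parity of the degrees of squares, whence `m` even
there.  Whether that hypothesis is necessary is not decided here (not treated).

References: [AbramovichTemkinWlodarczyk2024, Thm. 5.3.1 (2) (p. 1578), Lemma 5.2.6–5.2.10 (p. 1577), §3.4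
(p. 1570)]; [CossartJannsenSaito2020, Def. 1.26, §2.2 (p. 21), Def. 7.1 (p. 107), Thm. 8.16 (p. 121)];
[CossartPiltant2008, proof of Prop. 4.2 (τ and the first block)]; [Temkin2025, §1.2.2 (p. 4)].  Statements ours
(the cell's model) — NOT a resolution theorem, NOT summit progress.
-/

open MvPolynomial

namespace Literature.AlgebraicGeometry.Resolution.WeightedBlowup

variable {k : Type*} [Field k] {N : ℕ}

/-! ## §1 The germ `X_i² + X_j^m X_l + X_{e₁} X_{e₂}` and its Newton data -/

section Germ

variable (k) in
/-- `X_i² + X_j^m X_l + X_{e₁} X_{e₂}`: the umbrella `umbrella k i j l 2 m` plus a hyperbolic pair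
(spectators allowed). (construction) [cite: Temkin2025, §1.2.2 (1) (p. 4) (umbrella-type germs in positive
characteristic)] -/
noncomputable def umbrellaQuad (i j l e₁ e₂ : Fin N) (m : ℕ) : MvPolynomial (Fin N) k :=
  umbrella k i j l 2 m + X e₁ * X e₂

variable {i j l e₁ e₂ : Fin N} {m : ℕ}

/-- `umbrellaQuad = X_i² + X_j^m X_l + X_{e₁} X_{e₂}` (plumbing). [cite: Temkin2025, §1.2.2 (1) (p. 4)] -/
theorem umbrellaQuad_eq : umbrellaQuad k i j l e₁ e₂ m = X i ^ 2 + X j ^ m * X l + X e₁ * X e₂ := by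
  rw [umbrellaQuad, umbrella]

/-- The germ as a sum of three monomials (plumbing). [folklore] -/
private theorem umbrellaQuad_eq_sum :
    umbrellaQuad k i j l e₁ e₂ m =
      monomial (Finsupp.single i 2) 1 + monomial (umbExp j l m) 1 + monomial (umbExp e₁ e₂ 1) 1 := by
  rw [umbrellaQuad_eq, umbExp, umbExp, X_pow_eq_monomial, X_pow_eq_monomial,
    ← pow_one (X l : MvPolynomial (Fin N) k), X_pow_eq_monomial, monomial_mul, mul_one,
    ← pow_one (X e₁ : MvPolynomial (Fin N) k), ← pow_one (X e₂ : MvPolynomial (Fin N) k), X_pow_eq_monomial,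
    X_pow_eq_monomial, monomial_mul, mul_one]

/-- Exponent bookkeeping (plumbing). [folklore] -/
private theorem umbExp_apply₇ (j l : Fin N) (m : ℕ) (x : Fin N) :
    umbExp j l m x = (if j = x then m else 0) + (if l = x then 1 else 0) := by
  rw [umbExp, Finsupp.add_apply, Finsupp.single_apply, Finsupp.single_apply]

/-- The three exponents are distinct (plumbing). [folklore] -/
private theorem single_two_ne_umbExp₇ {j l : Fin N} {m : ℕ} (hil : i ≠ l) (hjl : j ≠ l) :
    Finsupp.single i 2 ≠ umbExp j l m := by
  intro h
  have := congrArg (fun d => d l) h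
  simp only [Finsupp.single_apply, if_neg hil, umbExp_apply₇, if_neg hjl, if_true] at this
  omega

/-- The three exponents are distinct (plumbing). [folklore] -/
private theorem umbExp_ne_umbExp_one (hjl : j ≠ l) (hl₁ : l ≠ e₁) (hl₂ : l ≠ e₂) :
    umbExp j l m ≠ umbExp e₁ e₂ 1 := by
  intro h
  have := congrArg (fun d => d l) h
  simp only [umbExp_apply₇, if_neg hjl, if_true, if_neg (Ne.symm hl₁), if_neg (Ne.symm hl₂)] at this
  omega

/-- Support of the germ (plumbing). [folklore] -/
private theorem mem_support_umbrellaQuad {d : Fin N →₀ ℕ} (hd : d ∈ (umbrellaQuad k i j l e₁ e₂ m).support) :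
    d = Finsupp.single i 2 ∨ d = umbExp j l m ∨ d = umbExp e₁ e₂ 1 := by
  rw [umbrellaQuad_eq_sum] at hd
  rcases Finset.mem_union.1 (support_add hd) with h1 | h1
  · rcases Finset.mem_union.1 (support_add h1) with h2 | h2
    · exact Or.inl (Finset.mem_singleton.1 (support_monomial_subset h2))
    · exact Or.inr (Or.inl (Finset.mem_singleton.1 (support_monomial_subset h2)))
  · exact Or.inr (Or.inr (Finset.mem_singleton.1 (support_monomial_subset h1)))

/-- Coefficients of the germ (plumbing). [folklore] -/
private theorem coeff_single_two_umbrellaQuad (hil : i ≠ l) (hi₂ : i ≠ e₂) (hjl : j ≠ l) (h₁₂ : e₁ ≠ e₂) :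
    coeff (Finsupp.single i 2) (umbrellaQuad k i j l e₁ e₂ m) = 1 := by
  rw [umbrellaQuad_eq_sum, coeff_add, coeff_add, coeff_monomial, coeff_monomial, coeff_monomial, if_pos rfl,
    if_neg (single_two_ne_umbExp₇ hil hjl).symm, if_neg (single_two_ne_umbExp₇ hi₂ h₁₂).symm, add_zero,
    add_zero]

/-- Coefficients of the germ (plumbing). [folklore] -/
private theorem coeff_umbExp_one_umbrellaQuad (hi₂ : i ≠ e₂) (hjl : j ≠ l) (hl₁ : l ≠ e₁) (hl₂ : l ≠ e₂)
    (h₁₂ : e₁ ≠ e₂) : coeff (umbExp e₁ e₂ 1) (umbrellaQuad k i j l e₁ e₂ m) = 1 := by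
  rw [umbrellaQuad_eq_sum, coeff_add, coeff_add, coeff_monomial, coeff_monomial, coeff_monomial,
    if_neg (single_two_ne_umbExp₇ hi₂ h₁₂), if_neg (umbExp_ne_umbExp_one hjl hl₁ hl₂), if_pos rfl, zero_add,
    zero_add]

/-- Degree of the umbrella exponent (plumbing). [folklore] -/
private theorem degree_umbExp₇ (j l : Fin N) (m : ℕ) : (umbExp j l m).degree = m + 1 := by
  rw [umbExp, map_add, Finsupp.degree_single, Finsupp.degree_single]

/-- **The order of `X_i² + X_j^m X_l + X_{e₁} X_{e₂}` is `2`** (`m ≥ 1`).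
[cite: AbramovichTemkinWlodarczyk2024, §5.1 (p. 1575) (a₁ = ord)] -/
theorem monomialOrd_umbrellaQuad (hil : i ≠ l) (hi₂ : i ≠ e₂) (hjl : j ≠ l) (h₁₂ : e₁ ≠ e₂) (hm : 1 ≤ m) :
    monomialOrd (fun _ => 1) (umbrellaQuad k i j l e₁ e₂ m) = 2 := by
  apply le_antisymm
  · have hmem : Finsupp.single i 2 ∈ (umbrellaQuad k i j l e₁ e₂ m).support := by
      rw [mem_support_iff, coeff_single_two_umbrellaQuad hil hi₂ hjl h₁₂]; exact one_ne_zero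
    refine (monomialOrd_le_weight (fun _ => 1) hmem).trans ?_
    rw [← Finsupp.degree_eq_weight_one, Finsupp.degree_single]
    simp
  · rw [show (2 : ℕ∞) = ((2 : ℕ) : ℕ∞) from rfl, le_monomialOrd_one_iff]
    intro d hd
    rcases mem_support_umbrellaQuad hd with rfl | rfl | rfl
    · rw [Finsupp.degree_single]
    · rw [degree_umbExp₇]; omega
    · rw [degree_umbExp₇]

/-- **The initial form is the rank-three quadratic form `X_i² + X_{e₁} X_{e₂}`** (`m ≠ 1`).
[cite: CossartJannsenSaito2020, Def. 8.2 (p. 118) (in_ν f)] -/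
theorem homogeneousComponent_umbrellaQuad (hm : m ≠ 1) :
    homogeneousComponent 2 (umbrellaQuad k i j l e₁ e₂ m) = X i ^ 2 + X e₁ * X e₂ := by
  rw [umbrellaQuad, map_add, homogeneousComponent_umbrella (by omega),
    homogeneousComponent_of_mem ((isHomogeneous_X k e₁).mul (isHomogeneous_X k e₂)), if_pos rfl]

/-- Evaluation of the quadratic part (plumbing). [folklore] -/
private theorem aeval_quadPart {A : Type*} [CommSemiring A] [Algebra k A] (v : Fin N → A) (i e₁ e₂ : Fin N) :
    aeval v (X i ^ 2 + X e₁ * X e₂ : MvPolynomial (Fin N) k) = v i ^ 2 + v e₁ * v e₂ := by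
  simp

/-- Variables of the quadratic part (plumbing). [folklore] -/
private theorem vars_quadPart_subset (i e₁ e₂ : Fin N) :
    (X i ^ 2 + X e₁ * X e₂ : MvPolynomial (Fin N) k).vars ⊆ {i, e₁, e₂} := by
  refine (vars_add_subset _ _).trans (Finset.union_subset ?_ ?_)
  · refine (vars_pow _ _).trans ?_
    rw [vars_X]; simp
  · refine (vars_mul _ _).trans (Finset.union_subset ?_ ?_)
    · rw [vars_X]; simp
    · rw [vars_X]; simp

/-- `C a · T = 0` in `k[T]` forces `a = 0` (plumbing). [folklore] -/
private theorem eq_zero_of_C_mul_X_eq_zero₇ {a : k} (h : Polynomial.C a * Polynomial.X = (0 : Polynomial k)) :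
    a = 0 := by
  rcases mul_eq_zero.1 h with h | h
  · exact Polynomial.C_eq_zero.1 h
  · exact absurd h Polynomial.X_ne_zero

/-- **`τ(X_i² + X_{e₁} X_{e₂}) = 3`** for distinct `i, e₁, e₂`, in EVERY characteristic and over EVERY field:
translation invariance is tested at the `k[T]`-valued points `T·w`, `e_{e₁} + T·w`, `e_{e₂} + T·w`
(`aeval_eq_of_mem_invarianceSpace_algebra`). (derived here) [cite: CossartJannsenSaito2020, Def. 1.26;
CossartPiltant2008, proof of Prop. 4.2] -/
theorem hironakaTau_sq_add_mul (hi₁ : i ≠ e₁) (hi₂ : i ≠ e₂) (h₁₂ : e₁ ≠ e₂) :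
    hironakaTau k {(X i ^ 2 + X e₁ * X e₂ : MvPolynomial (Fin N) k)} = 3 := by
  have hcard : ({i, e₁, e₂} : Finset (Fin N)).card = 3 := by
    rw [Finset.card_insert_of_notMem (by simp [hi₁, hi₂]), Finset.card_pair h₁₂]
  rw [← hcard]
  refine hironakaTau_singleton_eq_card (vars_quadPart_subset i e₁ e₂) fun w hw x hx => ?_
  have h0 := aeval_eq_of_mem_invarianceSpace_algebra hw (fun _ => (0 : Polynomial k)) Polynomial.X
  have h1 := aeval_eq_of_mem_invarianceSpace_algebra hw (Pi.single e₁ (1 : Polynomial k)) Polynomial.X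
  have h2 := aeval_eq_of_mem_invarianceSpace_algebra hw (Pi.single e₂ (1 : Polynomial k)) Polynomial.X
  simp only [aeval_quadPart, Polynomial.algebraMap_eq, zero_add] at h0
  simp only [aeval_quadPart, Polynomial.algebraMap_eq, Pi.single_eq_same, Pi.single_eq_of_ne hi₁,
    Pi.single_eq_of_ne (Ne.symm h₁₂), zero_add] at h1
  simp only [aeval_quadPart, Polynomial.algebraMap_eq, Pi.single_eq_same, Pi.single_eq_of_ne hi₂,
    Pi.single_eq_of_ne h₁₂, zero_add] at h2
  have hE₂ : Polynomial.C (w e₂) * Polynomial.X = 0 := by linear_combination h1 - h0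
  have hE₁ : Polynomial.C (w e₁) * Polynomial.X = 0 := by linear_combination h2 - h0
  have hI : (Polynomial.C (w i) * Polynomial.X) ^ 2 = 0 := by
    linear_combination h0 - Polynomial.C (w e₁) * Polynomial.X * hE₂
  have hwi : w i = 0 := eq_zero_of_C_mul_X_eq_zero₇ ((pow_eq_zero_iff two_ne_zero).1 hI)
  simp only [Finset.mem_insert, Finset.mem_singleton] at hx
  rcases hx with rfl | rfl | rfl
  exacts [hwi, eq_zero_of_C_mul_X_eq_zero₇ hE₁, eq_zero_of_C_mul_X_eq_zero₇ hE₂]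

/-- **`τ(in₂ f) = 3`** for the germ (`m ≠ 1`). [cite: CossartPiltant2008, proof of Prop. 4.2] -/
theorem hironakaTau_homogeneousComponent_umbrellaQuad (hi₁ : i ≠ e₁) (hi₂ : i ≠ e₂) (h₁₂ : e₁ ≠ e₂)
    (hm : m ≠ 1) :
    hironakaTau k {homogeneousComponent 2 (umbrellaQuad k i j l e₁ e₂ m)} = 3 := by
  rw [homogeneousComponent_umbrellaQuad hm]; exact hironakaTau_sq_add_mul hi₁ hi₂ h₁₂

end Germ

/-! ## §2 The coordinate centre `(X_i², X_{e₁}², X_{e₂}², X_j^{m+1}, X_l^{m+1})`: `(2, 2, 2, m+1, m+1) ∈ W` -/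

section Centre

variable {i j l e₁ e₂ : Fin N} {m : ℕ}

/-- The cocharacter of the coordinate centre `(X_i², X_{e₁}², X_{e₂}², X_j^{m+1}, X_l^{m+1})`.
[cite: AbramovichTemkinWlodarczyk2024, §5.1 (p. 1575)] -/
def umbrellaQuadWeights (i j l e₁ e₂ : Fin N) (m : ℕ) : Fin N → ℚ := fun x =>
  if x = i ∨ x = e₁ ∨ x = e₂ then 1 / 2 else if x = j ∨ x = l then (((m + 1 : ℕ) : ℚ))⁻¹ else 0

/-- Values of the cocharacter (plumbing). [folklore] -/
private theorem umbrellaQuadWeights_i : umbrellaQuadWeights i j l e₁ e₂ m i = 1 / 2 := by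
  simp [umbrellaQuadWeights]

/-- Values of the cocharacter (plumbing). [folklore] -/
private theorem umbrellaQuadWeights_e₁ : umbrellaQuadWeights i j l e₁ e₂ m e₁ = 1 / 2 := by
  simp [umbrellaQuadWeights]

/-- Values of the cocharacter (plumbing). [folklore] -/
private theorem umbrellaQuadWeights_e₂ : umbrellaQuadWeights i j l e₁ e₂ m e₂ = 1 / 2 := by
  simp [umbrellaQuadWeights]

/-- Values of the cocharacter (plumbing). [folklore] -/
private theorem umbrellaQuadWeights_j (hij : i ≠ j) (hj₁ : j ≠ e₁) (hj₂ : j ≠ e₂) :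
    umbrellaQuadWeights i j l e₁ e₂ m j = (((m + 1 : ℕ) : ℚ))⁻¹ := by
  simp [umbrellaQuadWeights, hij.symm, hj₁, hj₂]

/-- Values of the cocharacter (plumbing). [folklore] -/
private theorem umbrellaQuadWeights_l (hil : i ≠ l) (hl₁ : l ≠ e₁) (hl₂ : l ≠ e₂) :
    umbrellaQuadWeights i j l e₁ e₂ m l = (((m + 1 : ℕ) : ℚ))⁻¹ := by
  simp [umbrellaQuadWeights, hil.symm, hl₁, hl₂]

/-- Values of the cocharacter (plumbing). [folklore] -/
private theorem umbrellaQuadWeights_of_ne {x : Fin N} (h1 : x ≠ i) (h2 : x ≠ j) (h3 : x ≠ l) (h4 : x ≠ e₁)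
    (h5 : x ≠ e₂) : umbrellaQuadWeights i j l e₁ e₂ m x = 0 := by
  simp [umbrellaQuadWeights, h1, h2, h3, h4, h5]

/-- `exps` of the cocharacter is `[2, 2, 2, m+1, m+1]` (`m ≥ 1`). (derived here)
[cite: AbramovichTemkinWlodarczyk2024, §5.1 (p. 1575) (invariant (a₁,…,a_k) of the centre)] -/
theorem exps_umbrellaQuadWeights (hij : i ≠ j) (hil : i ≠ l) (hi₁ : i ≠ e₁) (hi₂ : i ≠ e₂) (hjl : j ≠ l)
    (hj₁ : j ≠ e₁) (hj₂ : j ≠ e₂) (hl₁ : l ≠ e₁) (hl₂ : l ≠ e₂) (h₁₂ : e₁ ≠ e₂) (hm : 1 ≤ m) :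
    exps (umbrellaQuadWeights i j l e₁ e₂ m) =
      [(2 : ℚ), 2, 2, ((m + 1 : ℕ) : ℚ), ((m + 1 : ℕ) : ℚ)] := by
  classical
  have hM0 : (((m + 1 : ℕ) : ℚ)) ≠ 0 := by positivity
  have hfilter : (Finset.univ.filter fun x => umbrellaQuadWeights i j l e₁ e₂ m x ≠ 0) = {i, e₁, e₂, j, l} := by
    ext x
    simp only [Finset.mem_filter, Finset.mem_univ, true_and, Finset.mem_insert, Finset.mem_singleton]
    constructor
    · intro hx
      by_contra hne
      push Not at hne
      exact hx (umbrellaQuadWeights_of_ne hne.1 hne.2.2.2.1 hne.2.2.2.2 hne.2.1 hne.2.2.1)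
    · rintro (rfl | rfl | rfl | rfl | rfl)
      · rw [umbrellaQuadWeights_i]; norm_num
      · rw [umbrellaQuadWeights_e₁]; norm_num
      · rw [umbrellaQuadWeights_e₂]; norm_num
      · rw [umbrellaQuadWeights_j hij hj₁ hj₂]; exact inv_ne_zero hM0
      · rw [umbrellaQuadWeights_l hil hl₁ hl₂]; exact inv_ne_zero hM0
  have h5 : (({i, e₁, e₂, j, l} : Finset (Fin N)).toList).Perm [i, e₁, e₂, j, l] :=
    (Finset.toList_insert (by simp [hij, hil, hi₁, hi₂])).trans
      (List.Perm.cons _ ((Finset.toList_insert (by simp [h₁₂, hj₁.symm, hl₁.symm])).trans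
        (List.Perm.cons _ ((Finset.toList_insert (by simp [hj₂.symm, hl₂.symm])).trans
          (List.Perm.cons _ ((Finset.toList_insert (by simp [hjl])).trans
            (List.Perm.of_eq (by rw [Finset.toList_singleton]))))))))
  have hperm : (exps (umbrellaQuadWeights i j l e₁ e₂ m)).Perm
      [(2 : ℚ), 2, 2, ((m + 1 : ℕ) : ℚ), ((m + 1 : ℕ) : ℚ)] := by
    unfold exps
    refine (List.perm_insertionSort _ _).trans ?_
    rw [hfilter]
    refine (h5.map _).trans (List.Perm.of_eq ?_)
    simp only [List.map_cons, List.map_nil, umbrellaQuadWeights_i, umbrellaQuadWeights_e₁,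
      umbrellaQuadWeights_e₂, umbrellaQuadWeights_j hij hj₁ hj₂, umbrellaQuadWeights_l hil hl₁ hl₂, inv_inv,
      one_div]
  have hsorted : [(2 : ℚ), 2, 2, ((m + 1 : ℕ) : ℚ), ((m + 1 : ℕ) : ℚ)].Pairwise (· ≤ ·) := by
    have h2 : (2 : ℚ) ≤ ((m + 1 : ℕ) : ℚ) := by
      have : (2 : ℕ) ≤ m + 1 := by omega
      exact_mod_cast this
    simp only [List.pairwise_cons, List.mem_cons, List.not_mem_nil, List.Pairwise.nil, forall_eq_or_imp,
      forall_eq, or_false, and_true, IsEmpty.forall_iff, implies_true]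
    exact ⟨⟨le_rfl, le_rfl, h2, h2⟩, ⟨le_rfl, h2, h2⟩, ⟨h2, h2⟩, le_rfl⟩
  exact hperm.eq_of_sortedLE (exps_sorted _).sortedLE hsorted.sortedLE

/-- The coordinate centre `(X_i², X_{e₁}², X_{e₂}², X_j^{m+1}, X_l^{m+1})` is admissible (`Ψ = id`).
(derived here) [cite: AbramovichTemkinWlodarczyk2024, §5.1 (p. 1575) and Rem. 5.2.3 (admissibility via v_J)] -/
theorem isCentreFor_umbrellaQuadWeights (hij : i ≠ j) (hil : i ≠ l) (hj₁ : j ≠ e₁) (hj₂ : j ≠ e₂)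
    (hl₁ : l ≠ e₁) (hl₂ : l ≠ e₂) :
    IsCentreFor (umbrellaQuad k i j l e₁ e₂ m) AlgEquiv.refl (umbrellaQuadWeights i j l e₁ e₂ m) := by
  have hM0 : (((m + 1 : ℕ) : ℚ)) ≠ 0 := by positivity
  refine ⟨fun x => constantCoeff_X k x, fun x => ?_, fun d hd => ?_⟩
  · unfold umbrellaQuadWeights
    split_ifs
    · norm_num
    · positivity
    · exact le_rfl
  · change d ∈ (umbrellaQuad k i j l e₁ e₂ m).support at hd
    rcases mem_support_umbrellaQuad hd with rfl | rfl | rfl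
    · rw [monomialValuation, Finsupp.sum_single_index (by simp), umbrellaQuadWeights_i]; norm_num
    · rw [umbExp, monomialValuation, Finsupp.sum_add_index' (by simp) (by intros; simp [add_mul]),
        Finsupp.sum_single_index (by simp), Finsupp.sum_single_index (by simp),
        umbrellaQuadWeights_j hij hj₁ hj₂, umbrellaQuadWeights_l hil hl₁ hl₂]
      rw [Nat.cast_one, one_mul, ← add_one_mul, ← Nat.cast_succ, mul_inv_cancel₀ hM0]
    · rw [umbExp, monomialValuation, Finsupp.sum_add_index' (by simp) (by intros; simp [add_mul]),
        Finsupp.sum_single_index (by simp), Finsupp.sum_single_index (by simp), umbrellaQuadWeights_e₁,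
        umbrellaQuadWeights_e₂]
      norm_num

/-- **`(2, 2, 2, m+1, m+1) ∈ W(X_i² + X_j^m X_l + X_{e₁} X_{e₂})`** (`m ≥ 1`). (derived here)
[cite: AbramovichTemkinWlodarczyk2024, §5.1 (p. 1575)] -/
theorem umbrellaQuad_inv_mem (hij : i ≠ j) (hil : i ≠ l) (hi₁ : i ≠ e₁) (hi₂ : i ≠ e₂) (hjl : j ≠ l)
    (hj₁ : j ≠ e₁) (hj₂ : j ≠ e₂) (hl₁ : l ≠ e₁) (hl₂ : l ≠ e₂) (h₁₂ : e₁ ≠ e₂) (hm : 1 ≤ m) :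
    [(2 : ℚ), 2, 2, ((m + 1 : ℕ) : ℚ), ((m + 1 : ℕ) : ℚ)] ∈
      admissibleInvariants (umbrellaQuad k i j l e₁ e₂ m) := by
  rw [← exps_umbrellaQuadWeights hij hil hi₁ hi₂ hjl hj₁ hj₂ hl₁ hl₂ h₁₂ hm]
  exact exps_mem_admissibleInvariants (isCentreFor_umbrellaQuadWeights hij hil hj₁ hj₂ hl₁ hl₂)

end Centre

/-! ## §3 The first block: nothing in `W` is above `(2, 2, 2)` -/

section FirstFace

variable {i j l e₁ e₂ : Fin N} {m : ℕ}

/-- Every non-zero weight contributes its inverse to `exps` (plumbing). [folklore] -/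
private theorem inv_mem_exps_of_ne_zero₇ {γ : Fin N → ℚ} {x : Fin N} (hx : γ x ≠ 0) : (γ x)⁻¹ ∈ exps γ := by
  classical
  unfold exps
  rw [List.mem_insertionSort, List.mem_map]
  exact ⟨x, Finset.mem_toList.2 (Finset.mem_filter.2 ⟨Finset.mem_univ _, hx⟩), rfl⟩

/-- Heads of sorted lists (plumbing). [folklore] -/
private theorem le_of_mem_of_pairwise₇ {a x : ℚ} {es : List ℚ} (hs : (a :: es).Pairwise (· ≤ ·))
    (hx : x ∈ a :: es) : a ≤ x := by
  rcases List.mem_cons.1 hx with rfl | hx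
  · exact le_rfl
  · exact (List.pairwise_cons.1 hs).1 x hx

/-- **First block: nothing in `W(X_i² + X_j^m X_l + X_{e₁} X_{e₂})` is above `(2, 2, 2)`** (`m ≥ 2`,
distinct indices, spectators allowed, EVERY characteristic, ALL polynomial coordinate changes): for
`b ∈ W(f)`, `b₁ ≤ 2`, and `b₁ = 2` forces the prefix `(2, 2, 2)` since `τ(in₂ f) = 3`. (derived here)
[cite: AbramovichTemkinWlodarczyk2024, Thm. 5.3.1 (2) (p. 1578) and its proof (b₁ ≤ a₁; τ entries)]
[cite: CossartPiltant2008, proof of Prop. 4.2] -/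
theorem not_lt_of_mem_admissibleInvariants_umbrellaQuad (hil : i ≠ l) (hi₁ : i ≠ e₁) (hi₂ : i ≠ e₂)
    (hjl : j ≠ l) (h₁₂ : e₁ ≠ e₂) (hm : 2 ≤ m) {b : List ℚ}
    (hb : b ∈ admissibleInvariants (umbrellaQuad k i j l e₁ e₂ m)) :
    ¬ ATW.TruncLex.lt [(2 : ℚ), 2, 2] b := by
  classical
  set f := umbrellaQuad k i j l e₁ e₂ m with hf
  have hord : monomialOrd (fun _ => 1) f = 2 := monomialOrd_umbrellaQuad hil hi₂ hjl h₁₂ (by omega)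
  have hτ : hironakaTau k {homogeneousComponent 2 f} = 3 :=
    hironakaTau_homogeneousComponent_umbrellaQuad hi₁ hi₂ h₁₂ (by omega)
  obtain ⟨Ψ, γ, h, rfl⟩ := hb
  have hsorted := exps_sorted γ
  by_cases hle' : ∀ x, γ x ≤ ((2 : ℕ) : ℚ)⁻¹
  · obtain ⟨t, ht⟩ := replicate_prefix_of_forall_le hord h hle'
    rw [hτ] at ht
    rw [← ht]
    simp only [List.replicate_succ, List.replicate_zero, List.cons_append, List.nil_append, Nat.cast_ofNat]
    rw [ATW.TruncLex.cons_lt_cons, ATW.TruncLex.cons_lt_cons, ATW.TruncLex.cons_lt_cons]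
    rintro (h1 | ⟨-, h2 | ⟨-, h3 | ⟨-, h4⟩⟩⟩)
    · exact lt_irrefl _ h1
    · exact lt_irrefl _ h2
    · exact lt_irrefl _ h3
    · exact ATW.TruncLex.not_nil_lt _ h4
  · push Not at hle'
    obtain ⟨x, hx⟩ := hle'
    rw [Nat.cast_two] at hx
    have hγx : γ x ≠ 0 := (lt_trans (by norm_num) hx).ne'
    have hlt : (γ x)⁻¹ < 2 := inv_lt_of_inv_lt₀ (by norm_num) hx
    have hmem := inv_mem_exps_of_ne_zero₇ hγx
    obtain ⟨a, es, hes⟩ : ∃ a es, exps γ = a :: es := by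
      cases hq' : exps γ with
      | nil => rw [hq'] at hmem; simp at hmem
      | cons a es => exact ⟨a, es, rfl⟩
    rw [hes] at hmem hsorted ⊢
    have ha : a < 2 := (le_of_mem_of_pairwise₇ hsorted hmem).trans_lt hlt
    rw [ATW.TruncLex.cons_lt_cons]
    rintro (h1 | ⟨h2, -⟩)
    · exact lt_asymm ha h1
    · exact ha.ne' h2

end FirstFace

/-! ## §4 The second vertex `(2, 2, 2, m+1, m+1)` -/

section SecondVertex

variable {i j l e₁ e₂ : Fin N} {m : ℕ}

/-- Slice `0` of a `SliceOrd` bound (plumbing). [folklore] -/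
private theorem SliceOrd.coeff_zero_le₇ {σ : Type*} {w : σ → ℕ} {α s : ℕ} {P : Polynomial (MvPolynomial σ k)}
    (h : SliceOrd w α s P) : (s : ℕ∞) ≤ monomialOrd w (P.coeff 0) := by
  simpa using h 0

/-- Slice `1` of a `SliceOrd` bound (plumbing). [folklore] -/
private theorem SliceOrd.coeff_one_le₇ {σ : Type*} {w : σ → ℕ} {α s : ℕ} {P : Polynomial (MvPolynomial σ k)}
    (h : SliceOrd w α s P) : ((s - α : ℕ) : ℕ∞) ≤ monomialOrd w (P.coeff 1) := by
  simpa using h 1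

/-- Coefficients of the normal form `C p₀ + C p₁ ε + C p₂ ε² + C p₃ ε³` (plumbing). [folklore] -/
private theorem coeff_normalForm₇ {R : Type*} [CommSemiring R] (p₀ p₁ p₂ p₃ : R) :
    (Polynomial.C p₀ + Polynomial.C p₁ * Polynomial.X + Polynomial.C p₂ * Polynomial.X ^ 2 +
        Polynomial.C p₃ * Polynomial.X ^ 3).coeff 0 = p₀ ∧
    (Polynomial.C p₀ + Polynomial.C p₁ * Polynomial.X + Polynomial.C p₂ * Polynomial.X ^ 2 +
        Polynomial.C p₃ * Polynomial.X ^ 3).coeff 1 = p₁ := by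
  simp only [Polynomial.coeff_add, Polynomial.coeff_C, Polynomial.coeff_C_mul_X, Polynomial.coeff_C_mul_X_pow]
  simp

/-- The weight as a sum over all variables (plumbing). [folklore] -/
private theorem weight_eq_sum_univ₇ (w : Fin N → ℕ) (dd : Fin N →₀ ℕ) : Finsupp.weight w dd = ∑ x, dd x * w x := by
  rw [Finsupp.weight_apply, Finsupp.sum_fintype dd _ (fun _ => by simp)]
  simp only [smul_eq_mul]

/-- The monomial valuation as a sum over all variables (plumbing). [folklore] -/
private theorem monomialValuation_eq_sum_univ₇ (γ : Fin N → ℚ) (dd : Fin N →₀ ℕ) :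
    monomialValuation γ dd = ∑ x, (dd x : ℚ) * γ x := by
  rw [monomialValuation, Finsupp.sum_fintype]
  intro i; simp

/-- Linear coefficients of a polynomial with vanishing linear part (plumbing). [folklore] -/
private theorem coeff_single_one_eq_zero_of_lin {P : MvPolynomial (Fin N) k} (h : homogeneousComponent 1 P = 0)
    (s : Fin N) : coeff (Finsupp.single s 1) P = 0 := by
  classical
  have := congrArg (coeff (Finsupp.single s 1)) h
  rwa [coeff_homogeneousComponent, if_pos (by rw [Finsupp.degree_single]), coeff_zero] at this

/-- **Second vertex, weight form.**  For `f = X_i² + X_j^m X_l + X_{e₁} X_{e₂}` (`i, j, l, e₁, e₂` distinct,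
spectators allowed, `m ≥ 2`; `2 ≠ 0` in `k` or `m` even) there is NO centre `(Ψ, γ)` — `Ψ` ANY polynomial
automorphism fixing the origin — with weights `γ a₁ = γ a₂ = γ a₃ = 1/2`, `γ d ≤ 1/(m+1)` for a variable `d`
outside `{a₁, a₂, a₃}`, and all other weights `≤ q/p` where `(m+1)q < p`. (derived here)
[cite: AbramovichTemkinWlodarczyk2024, Thm. 5.3.1 (2) (p. 1578), Lemma 5.2.6–5.2.10 (p. 1577), §3.4 (p. 1570);
CossartJannsenSaito2020, Def. 7.1 (p. 107), §2.2 (p. 21); Temkin2025, §1.2.2 (1) (p. 4)] -/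
theorem not_isCentreFor_umbrellaQuad_vertex (hij : i ≠ j) (hil : i ≠ l) (hi₁ : i ≠ e₁) (hi₂ : i ≠ e₂)
    (hjl : j ≠ l) (hj₁ : j ≠ e₁) (hj₂ : j ≠ e₂) (hl₁ : l ≠ e₁) (hl₂ : l ≠ e₂) (h₁₂ : e₁ ≠ e₂) (hm : 2 ≤ m)
    (hchar2 : (2 : k) ≠ 0 ∨ Even m)
    {Ψ : MvPolynomial (Fin N) k ≃ₐ[k] MvPolynomial (Fin N) k} {γ : Fin N → ℚ} {a₁ a₂ a₃ d : Fin N}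
    (hγa₁ : γ a₁ = 1 / 2) (hγa₂ : γ a₂ = 1 / 2) (hγa₃ : γ a₃ = 1 / 2) (hd₁ : d ≠ a₁) (hd₂ : d ≠ a₂)
    (hd₃ : d ≠ a₃) (hγd : γ d ≤ 1 / ((m + 1 : ℕ) : ℚ)) {p q : ℕ} (hpq : (m + 1) * q < p)
    (hE : ∀ x, x ≠ a₁ → x ≠ a₂ → x ≠ a₃ → x ≠ d → γ x ≤ (q : ℚ) / p) :
    ¬ IsCentreFor (umbrellaQuad k i j l e₁ e₂ m) Ψ γ := by
  classical
  intro hc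
  set f := umbrellaQuad k i j l e₁ e₂ m with hf
  obtain ⟨K, hK⟩ : ∃ K, (m + 1) * p = K := ⟨_, rfl⟩
  have hp0 : 0 < p := by omega
  have hK6 : 6 * (m + 1) * p = 6 * K := by rw [← hK]; ring
  have hM0 : (0 : ℚ) < ((m + 1 : ℕ) : ℚ) := by positivity
  -- the restriction `ρ = κ ∘ Ψ⁻¹`, `κ` killing `X_{a₁}, X_{a₂}, X_{a₃}`
  set H : Finset (Fin N) := {a₁, a₂, a₃} with hH
  have hdH : d ∉ H := by simp [hH, hd₁, hd₂, hd₃]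
  have hnotH : ∀ x, x ∉ H → x ≠ a₁ ∧ x ≠ a₂ ∧ x ≠ a₃ := fun x hx => by
    simpa only [hH, Finset.mem_insert, Finset.mem_singleton, not_or] using hx
  obtain ⟨ρ, hρ⟩ : ∃ ρ : MvPolynomial (Fin N) k →ₐ[k] MvPolynomial (Fin N) k,
      ∀ P, ρ P = killHom H (Ψ.symm P) :=
    ⟨(killHom H).comp (Ψ.symm : MvPolynomial (Fin N) k →ₐ[k] MvPolynomial (Fin N) k), fun _ => rfl⟩
  have hρΨ : ∀ x, ρ (Ψ (X x)) = killHom H (X x) := fun x => by rw [hρ, AlgEquiv.symm_apply_apply]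
  have hρA : ∀ x, x ∈ H → ρ (Ψ (X x)) = 0 := fun x hx => by rw [hρΨ, killHom_X_of_mem hx]
  have hρx : ∀ x, x ∉ H → ρ (Ψ (X x)) = X x := fun x hx => by rw [hρΨ, killHom_X_of_not_mem hx]
  have hΨs0 : ∀ x, constantCoeff (Ψ.symm (X x)) = 0 := constantCoeff_symm_X_eq_zero_of_forall Ψ hc.1
  have hρX0 : ∀ x, constantCoeff (ρ (X x)) = 0 := fun x => by rw [hρ, constantCoeff_killHom, hΨs0]
  have hρ1 : ∀ P y, y ∉ H → coeff (Finsupp.single y 1) (ρ P) = coeff (Finsupp.single y 1) (Ψ.symm P) := by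
    intro P y hy
    rw [hρ, coeff_killHom_of_forall_eq_zero]
    intro x hx
    exact Finsupp.single_eq_of_ne (ne_of_mem_of_not_mem hx hy)
  set V := ρ (X i) with hV
  set W := ρ (X j) with hW
  set U := ρ (X l) with hU
  set E₁ := ρ (X e₁) with hE₁
  set E₂ := ρ (X e₂) with hE₂
  have hV0 : constantCoeff V = 0 := hρX0 i
  have hW0 : constantCoeff W = 0 := hρX0 j
  have hU0 : constantCoeff U = 0 := hρX0 l
  have hE₁0 : constantCoeff E₁ = 0 := hρX0 e₁
  have hE₂0 : constantCoeff E₂ = 0 := hρX0 e₂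
  -- integer weights: `6p` on `X_d`, `6(m+1)q` elsewhere; source weights `qs`
  obtain ⟨Wt, hWt⟩ : ∃ Wt : Fin N → ℕ, Wt = heavyWeights d (m + 1) p q := ⟨_, rfl⟩
  have hWtle : ∀ x, Wt x ≤ 2 * K := by
    intro x
    rw [hWt, heavyWeights]
    split_ifs
    · nlinarith
    · nlinarith
  obtain ⟨qs, hqs⟩ : ∃ qs : Fin N → ℕ, ∀ x, qs x = if x ∈ H then 3 * K else Wt x := ⟨_, fun _ => rfl⟩
  have hqsA : ∀ x, x ∈ H → qs x = 3 * K := fun x hx => by rw [hqs, if_pos hx]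
  have hqsx : ∀ x, x ∉ H → qs x = Wt x := fun x hx => by rw [hqs, if_neg hx]
  -- admissibility of `Ψ⁻¹ f` in the source weights
  have hqsγ : ∀ x, (6 * K : ℚ) * γ x ≤ (qs x : ℚ) := by
    intro x
    by_cases hxH : x ∈ H
    · have hγx : γ x = 1 / 2 := by
        simp only [hH, Finset.mem_insert, Finset.mem_singleton] at hxH
        rcases hxH with rfl | rfl | rfl
        exacts [hγa₁, hγa₂, hγa₃]
      rw [hqsA x hxH, hγx]; push_cast; linarith
    obtain ⟨hx₁, hx₂, hx₃⟩ := hnotH x hxH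
    rw [hqsx x hxH, hWt, heavyWeights]
    have hKq : (K : ℚ) = ((m + 1 : ℕ) : ℚ) * p := by rw [← hK]; push_cast; ring
    by_cases hxd : x = d
    · rw [if_pos hxd, hxd]
      calc (6 * K : ℚ) * γ d ≤ 6 * K * (1 / ((m + 1 : ℕ) : ℚ)) := mul_le_mul_of_nonneg_left hγd (by positivity)
        _ = ((6 * p : ℕ) : ℚ) := by rw [hKq]; field_simp; push_cast; ring
    · rw [if_neg hxd]
      calc (6 * K : ℚ) * γ x ≤ 6 * K * ((q : ℚ) / p) :=
            mul_le_mul_of_nonneg_left (hE x hx₁ hx₂ hx₃ hxd) (by positivity)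
        _ = ((6 * (m + 1) * q : ℕ) : ℚ) := by
          rw [hKq]; field_simp; push_cast; ring
  have hadm : ∀ dd ∈ (Ψ.symm f).support, 6 * K ≤ Finsupp.weight qs dd := by
    intro dd hdd
    have h1 : (1 : ℚ) ≤ ∑ x, (dd x : ℚ) * γ x := by
      rw [← monomialValuation_eq_sum_univ₇]; exact hc.2.2 dd hdd
    have h2 : ((Finsupp.weight qs dd : ℕ) : ℚ) = ∑ x, (dd x : ℚ) * (qs x : ℚ) := by
      rw [weight_eq_sum_univ₇]; push_cast; rfl
    have h3 : ((6 * K : ℕ) : ℚ) ≤ ∑ x, (dd x : ℚ) * (qs x : ℚ) := by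
      calc ((6 * K : ℕ) : ℚ) = (6 * K : ℚ) * 1 := by push_cast; ring
        _ ≤ (6 * K : ℚ) * ∑ x, (dd x : ℚ) * γ x := mul_le_mul_of_nonneg_left h1 (by positivity)
        _ = ∑ x, (dd x : ℚ) * ((6 * K : ℚ) * γ x) := by
          rw [Finset.mul_sum]; exact Finset.sum_congr rfl fun x _ => by ring
        _ ≤ ∑ x, (dd x : ℚ) * (qs x : ℚ) :=
          Finset.sum_le_sum fun x _ => mul_le_mul_of_nonneg_left (hqsγ x) (by positivity)
    rw [← h2] at h3
    exact_mod_cast h3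
  -- SliceOrd bounds for the generators (all from the `ε⁰`-slice), and the transfer to `f`
  have hgen : ∀ (ξ : Fin N → MvPolynomial (Fin N) k) (x : Fin N),
      SliceOrd Wt (3 * K) (qs x) (fieldTaylorₐ ρ ξ (Ψ (X x))) := by
    intro ξ x
    by_cases hxH : x ∈ H
    · rw [hqsA x hxH]
      refine sliceOrd_of_coeff ?_ ?_ (by omega)
      · rw [coeff_zero_fieldTaylorₐ, hρA x hxH, monomialOrd_zero]; exact le_top
      · rw [Nat.sub_self, Nat.cast_zero]; exact zero_le
    · have hq2 : qs x ≤ 2 * K := by rw [hqsx x hxH]; exact hWtle x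
      refine sliceOrd_of_coeff ?_ ?_ (by omega)
      · rw [coeff_zero_fieldTaylorₐ, hρx x hxH, monomialOrd_X, hqsx x hxH]
      · rw [Nat.sub_eq_zero_of_le (by omega), Nat.cast_zero]; exact zero_le
  have hTf : ∀ ξ : Fin N → MvPolynomial (Fin N) k, SliceOrd Wt (3 * K) (6 * K) (fieldTaylorₐ ρ ξ f) := by
    intro ξ
    have h := SliceOrd.map (φ := (fieldTaylorₐ ρ ξ).comp (Ψ : MvPolynomial (Fin N) k →ₐ[k] MvPolynomial (Fin N) k))
      qs (fun x => hgen ξ x) (F := Ψ.symm f) hadm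
    have h' : SliceOrd Wt (3 * K) (6 * K) (fieldTaylorₐ ρ ξ (Ψ (Ψ.symm f))) := h
    rwa [AlgEquiv.apply_symm_apply] at h'
  -- (T_i) the direction `∂_i`
  set ξ₀ : Fin N → MvPolynomial (Fin N) k := fun x => if x = i then 1 else 0 with hξ₀
  have hexp0 : fieldTaylorₐ ρ ξ₀ f = Polynomial.C (V ^ 2 + W ^ m * U + E₁ * E₂) +
      Polynomial.C (2 * V) * Polynomial.X + Polynomial.C 1 * Polynomial.X ^ 2 + Polynomial.C 0 * Polynomial.X ^ 3 := by
    have e1 : ξ₀ i = 1 := by simp [hξ₀]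
    have e2 : ξ₀ j = 0 := by simp [hξ₀, hij.symm]
    have e3 : ξ₀ l = 0 := by simp [hξ₀, hil.symm]
    have e4 : ξ₀ e₁ = 0 := by simp [hξ₀, hi₁.symm]
    have e5 : ξ₀ e₂ = 0 := by simp [hξ₀, hi₂.symm]
    rw [hf, umbrellaQuad_eq]
    simp only [map_add, map_mul, map_pow, fieldTaylorₐ_X, e1, e2, e3, e4, e5, map_one, map_zero, mul_zero,
      add_zero]
    simp only [map_ofNat]
    ring
  have hG : ((6 * K : ℕ) : ℕ∞) ≤ monomialOrd Wt (V ^ 2 + W ^ m * U + E₁ * E₂) := by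
    have h := (hTf ξ₀).coeff_zero_le₇; rwa [hexp0, (coeff_normalForm₇ _ _ _ _).1] at h
  have hEv : ((3 * K : ℕ) : ℕ∞) ≤ monomialOrd Wt (2 * V) := by
    have h := (hTf ξ₀).coeff_one_le₇
    rwa [hexp0, (coeff_normalForm₇ _ _ _ _).2, show 6 * K - 3 * K = 3 * K by omega] at h
  -- (T_{e₁}) the direction `∂_{e₁}`: `ord E₂ ≥ 3K`
  set ξ₁ : Fin N → MvPolynomial (Fin N) k := fun x => if x = e₁ then 1 else 0 with hξ₁
  have hexp1 : fieldTaylorₐ ρ ξ₁ f = Polynomial.C (V ^ 2 + W ^ m * U + E₁ * E₂) +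
      Polynomial.C E₂ * Polynomial.X + Polynomial.C 0 * Polynomial.X ^ 2 + Polynomial.C 0 * Polynomial.X ^ 3 := by
    have e1 : ξ₁ i = 0 := by simp [hξ₁, hi₁]
    have e2 : ξ₁ j = 0 := by simp [hξ₁, hj₁]
    have e3 : ξ₁ l = 0 := by simp [hξ₁, hl₁]
    have e4 : ξ₁ e₁ = 1 := by simp [hξ₁]
    have e5 : ξ₁ e₂ = 0 := by simp [hξ₁, h₁₂.symm]
    rw [hf, umbrellaQuad_eq]
    simp only [map_add, map_mul, map_pow, fieldTaylorₐ_X, e1, e2, e3, e4, e5, map_one, map_zero, mul_zero,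
      add_zero]
    ring
  have hE₂3 : ((3 * K : ℕ) : ℕ∞) ≤ monomialOrd Wt E₂ := by
    have h := (hTf ξ₁).coeff_one_le₇
    rwa [hexp1, (coeff_normalForm₇ _ _ _ _).2, show 6 * K - 3 * K = 3 * K by omega] at h
  -- (T_{e₂}) the direction `∂_{e₂}`: `ord E₁ ≥ 3K`
  set ξ₂ : Fin N → MvPolynomial (Fin N) k := fun x => if x = e₂ then 1 else 0 with hξ₂
  have hexp2 : fieldTaylorₐ ρ ξ₂ f = Polynomial.C (V ^ 2 + W ^ m * U + E₁ * E₂) +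
      Polynomial.C E₁ * Polynomial.X + Polynomial.C 0 * Polynomial.X ^ 2 + Polynomial.C 0 * Polynomial.X ^ 3 := by
    have e1 : ξ₂ i = 0 := by simp [hξ₂, hi₂]
    have e2 : ξ₂ j = 0 := by simp [hξ₂, hj₂]
    have e3 : ξ₂ l = 0 := by simp [hξ₂, hl₂]
    have e4 : ξ₂ e₁ = 0 := by simp [hξ₂, h₁₂]
    have e5 : ξ₂ e₂ = 1 := by simp [hξ₂]
    rw [hf, umbrellaQuad_eq]
    simp only [map_add, map_mul, map_pow, fieldTaylorₐ_X, e1, e2, e3, e4, e5, map_one, map_zero, mul_zero,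
      add_zero]
    ring
  have hE₁3 : ((3 * K : ℕ) : ℕ∞) ≤ monomialOrd Wt E₁ := by
    have h := (hTf ξ₂).coeff_one_le₇
    rwa [hexp2, (coeff_normalForm₇ _ _ _ _).2, show 6 * K - 3 * K = 3 * K by omega] at h
  -- low-degree components (`M = m + 1`): `in_n` of `G`, `V²`, `E₁ E₂`, `E₁²`, `E₂²`
  have hpq' : (m + 1) * q < p := hpq
  have h6K : ∀ P Q : MvPolynomial (Fin N) k, ((3 * K : ℕ) : ℕ∞) ≤ monomialOrd Wt P →
      ((3 * K : ℕ) : ℕ∞) ≤ monomialOrd Wt Q →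
      ((6 * (m + 1) * p : ℕ) : ℕ∞) ≤ monomialOrd (heavyWeights d (m + 1) p q) (P * Q) := by
    intro P Q hP hQ
    rw [hK6, ← hWt, show 6 * K = 3 * K + 3 * K by omega, Nat.cast_add]
    exact (add_le_add hP hQ).trans (add_monomialOrd_le_mul Wt P Q)
  have hVsq : ∃ κ : k, homogeneousComponent (m + 1) (V ^ 2) = C κ * X d ^ (m + 1) := by
    by_cases h2 : (2 : k) = 0
    · refine ⟨0, ?_⟩
      rw [C_0, zero_mul]
      have heven : Even m := hchar2.resolve_left (not_not.2 h2)
      exact homogeneousComponent_sq_eq_zero_of_odd h2 heven.add_one V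
    · have hu2 : constantCoeff (2 : MvPolynomial (Fin N) k) ≠ 0 := by rwa [map_ofNat]
      have hV3 : ((3 * K : ℕ) : ℕ∞) ≤ monomialOrd Wt V := by
        rwa [monomialOrd_mul_of_constantCoeff_ne_zero Wt hu2] at hEv
      have hV6 := h6K V V hV3 hV3
      rw [← pow_two] at hV6
      exact ⟨_, (homogeneousComponent_of_le_monomialOrd_heavyWeights hpq' hV6).2⟩
  obtain ⟨hEElow, hEEM⟩ := homogeneousComponent_of_le_monomialOrd_heavyWeights hpq' (h6K E₁ E₂ hE₁3 hE₂3)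
  have hE₁sq := (homogeneousComponent_of_le_monomialOrd_heavyWeights hpq' (h6K E₁ E₁ hE₁3 hE₁3)).1 2 (by omega)
  have hE₂sq := (homogeneousComponent_of_le_monomialOrd_heavyWeights hpq' (h6K E₂ E₂ hE₂3 hE₂3)).1 2 (by omega)
  have hG' : ((6 * (m + 1) * p : ℕ) : ℕ∞) ≤
      monomialOrd (heavyWeights d (m + 1) p q) (V ^ 2 + W ^ m * U + E₁ * E₂) := by
    rw [hK6, ← hWt]; exact hG
  obtain ⟨hGlow, hGM⟩ := homogeneousComponent_of_le_monomialOrd_heavyWeights hpq' hG'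
  -- degree-order bounds
  have hV1 : ((1 : ℕ) : ℕ∞) ≤ monomialOrd (fun _ => 1) V := by
    rw [Nat.cast_one]; exact one_le_monomialOrd_one_of_constantCoeff_eq_zero _ hV0
  have hW1 : ((1 : ℕ) : ℕ∞) ≤ monomialOrd (fun _ => 1) W := by
    rw [Nat.cast_one]; exact one_le_monomialOrd_one_of_constantCoeff_eq_zero _ hW0
  have hU1 : ((1 : ℕ) : ℕ∞) ≤ monomialOrd (fun _ => 1) U := by
    rw [Nat.cast_one]; exact one_le_monomialOrd_one_of_constantCoeff_eq_zero _ hU0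
  have hE₁1 : ((1 : ℕ) : ℕ∞) ≤ monomialOrd (fun _ => 1) E₁ := by
    rw [Nat.cast_one]; exact one_le_monomialOrd_one_of_constantCoeff_eq_zero _ hE₁0
  have hE₂1 : ((1 : ℕ) : ℕ∞) ≤ monomialOrd (fun _ => 1) E₂ := by
    rw [Nat.cast_one]; exact one_le_monomialOrd_one_of_constantCoeff_eq_zero _ hE₂0
  have hWm : ((m : ℕ) : ℕ∞) ≤ monomialOrd (fun _ => 1) (W ^ m) := by
    have h := nsmul_monomialOrd_le_pow (fun _ => 1) W m
    refine le_trans ?_ h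
    calc ((m : ℕ) : ℕ∞) = m • ((1 : ℕ) : ℕ∞) := by rw [Nat.cast_one, nsmul_one]
      _ ≤ m • monomialOrd (fun _ => 1) W := nsmul_le_nsmul_right hW1 m
  have hWU : ((m + 1 : ℕ) : ℕ∞) ≤ monomialOrd (fun _ => 1) (W ^ m * U) := by
    rw [Nat.cast_add]
    exact (add_le_add hWm hU1).trans (add_monomialOrd_le_mul _ _ _)
  -- `lin E₁ = lin E₂ = 0` from `in₂(E_r²) = (lin E_r)² = 0`
  have hlinE₁ : homogeneousComponent 1 E₁ = 0 := by
    have hsq := homogeneousComponent_mul_pow_of_le_monomialOrd E₁ hE₁1 2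
    rw [← pow_two] at hE₁sq
    rw [Nat.mul_one, hE₁sq] at hsq
    exact pow_eq_zero_iff two_ne_zero |>.1 hsq.symm
  have hlinE₂ : homogeneousComponent 1 E₂ = 0 := by
    have hsq := homogeneousComponent_mul_pow_of_le_monomialOrd E₂ hE₂1 2
    rw [← pow_two] at hE₂sq
    rw [Nat.mul_one, hE₂sq] at hsq
    exact pow_eq_zero_iff two_ne_zero |>.1 hsq.symm
  -- `lin V = 0` from `in₂ G = 0`
  have hlinV : homogeneousComponent 1 V = 0 := by
    have h2G := hGlow 2 (by omega)
    have hsq := homogeneousComponent_mul_pow_of_le_monomialOrd V hV1 2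
    rw [Nat.mul_one] at hsq
    rw [map_add, map_add, hsq, homogeneousComponent_eq_zero_of_lt_monomialOrd _ (by omega : 2 < m + 1) hWU,
      hEElow 2 (by omega), add_zero, add_zero] at h2G
    exact pow_eq_zero_iff two_ne_zero |>.1 h2G
  -- `(lin W)^m · lin U = κ X_d^{m+1}`
  obtain ⟨κV, hκV⟩ := hVsq
  have hprod : homogeneousComponent (m + 1) (W ^ m * U) =
      homogeneousComponent 1 W ^ m * homogeneousComponent 1 U := by
    have hpw := homogeneousComponent_mul_pow_of_le_monomialOrd W hW1 m
    rw [Nat.mul_one] at hpw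
    rw [homogeneousComponent_add_mul_of_le_monomialOrd (W ^ m) U hWm hU1, hpw]
  set κG := coeff (Finsupp.single d (m + 1)) (V ^ 2 + W ^ m * U + E₁ * E₂) with hκG
  set κE := coeff (Finsupp.single d (m + 1)) (E₁ * E₂) with hκE
  have hstar : linForm (fun y => coeff (Finsupp.single y 1) W) ^ m *
      linForm (fun y => coeff (Finsupp.single y 1) U) = C (κG - κV - κE) * X d ^ (m + 1) := by
    rw [← homogeneousComponent_one_eq_linForm, ← homogeneousComponent_one_eq_linForm, ← hprod]
    rw [map_add, map_add, hκV, hEEM] at hGM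
    have : homogeneousComponent (m + 1) (W ^ m * U) =
        C κG * X d ^ (m + 1) - C κV * X d ^ (m + 1) - C κE * X d ^ (m + 1) := by
      rw [← hGM]; ring
    rw [this, map_sub, map_sub]; ring
  -- rows of the Jacobian of `Ψ⁻¹` at `0`
  have hrow : ∀ x s, s ∉ H → coeff (Finsupp.single s 1) (ρ (X x)) = 0 →
      coeff (Finsupp.single s 1) (Ψ.symm (X x)) = 0 := by
    intro x s hs h
    rwa [hρ1 (X x) s hs] at h
  have hrowV := coeff_single_one_eq_zero_of_lin hlinV
  have hrowE₁ := coeff_single_one_eq_zero_of_lin hlinE₁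
  have hrowE₂ := coeff_single_one_eq_zero_of_lin hlinE₂
  have hsH : ∀ s, s ≠ a₁ → s ≠ a₂ → s ≠ a₃ → s ∉ H := fun s h1 h2 h3 => by
    simp [hH, h1, h2, h3]
  have hcard4 : ∀ x : Fin N, x ≠ i → x ≠ e₁ → x ≠ e₂ → ({i, e₁, e₂, x} : Finset (Fin N)).card = 4 := by
    intro x h1 h2 h3
    rw [Finset.card_insert_of_notMem (by simp [hi₁, hi₂, Ne.symm h1]),
      Finset.card_insert_of_notMem (by simp [h₁₂, Ne.symm h2]), Finset.card_pair (Ne.symm h3)]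
  rcases linForm_trichotomy (by omega : 1 ≤ m) hstar with hboth | hWz | hUz
  · -- rows `i, e₁, e₂, j, l` supported on the columns `a₁, a₂, a₃, d`
    refine false_of_jacobian_rows_supported hc.1 {j, i, e₁, e₂, l} {a₁, a₂, a₃, d}
      (lt_of_le_of_lt Finset.card_le_four (by
        rw [Finset.card_insert_of_notMem (by simp [hij.symm, hj₁, hj₂, hjl]), hcard4 l hil.symm hl₁ hl₂]
        norm_num)) ?_
    intro s hs x hx
    simp only [Finset.mem_insert, Finset.mem_singleton, not_or] at hs hx
    obtain ⟨hs1, hs2, hs3, hsd⟩ := hs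
    refine hrow x s (hsH s hs1 hs2 hs3) ?_
    rcases hx with rfl | rfl | rfl | rfl | rfl
    · exact (hboth s hsd).1
    · exact hrowV s
    · exact hrowE₁ s
    · exact hrowE₂ s
    · exact (hboth s hsd).2
  · -- rows `i, e₁, e₂, j` supported on the columns `a₁, a₂, a₃`
    refine false_of_jacobian_rows_supported hc.1 {i, e₁, e₂, j} {a₁, a₂, a₃}
      (lt_of_le_of_lt Finset.card_le_three (by rw [hcard4 j hij.symm hj₁ hj₂]; norm_num)) ?_
    intro s hs x hx
    simp only [Finset.mem_insert, Finset.mem_singleton, not_or] at hs hx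
    obtain ⟨hs1, hs2, hs3⟩ := hs
    refine hrow x s (hsH s hs1 hs2 hs3) ?_
    rcases hx with rfl | rfl | rfl | rfl
    · exact hrowV s
    · exact hrowE₁ s
    · exact hrowE₂ s
    · exact hWz s
  · -- rows `i, e₁, e₂, l` supported on the columns `a₁, a₂, a₃`
    refine false_of_jacobian_rows_supported hc.1 {i, e₁, e₂, l} {a₁, a₂, a₃}
      (lt_of_le_of_lt Finset.card_le_three (by rw [hcard4 l hil.symm hl₁ hl₂]; norm_num)) ?_
    intro s hs x hx
    simp only [Finset.mem_insert, Finset.mem_singleton, not_or] at hs hx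
    obtain ⟨hs1, hs2, hs3⟩ := hs
    refine hrow x s (hsH s hs1 hs2 hs3) ?_
    rcases hx with rfl | rfl | rfl | rfl
    · exact hrowV s
    · exact hrowE₁ s
    · exact hrowE₂ s
    · exact hUz s

end SecondVertex

/-! ## §5 From weights to invariants: `max W = (2, 2, 2, m+1, m+1)` -/

section Assembly

variable {i j l e₁ e₂ : Fin N} {m : ℕ}

/-- Non-negativity survives forgetting a variable (plumbing). [folklore] -/
private theorem update_nonneg₇ {γ : Fin N → ℚ} (hγ : ∀ x, 0 ≤ γ x) (a : Fin N) (x : Fin N) :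
    0 ≤ Function.update γ a 0 x := by
  by_cases hx : x = a
  · subst hx; simp
  · rw [Function.update_of_ne hx]; exact hγ x

/-- Four distinct indices leave one outside any triple (plumbing). [folklore] -/
private theorem exists_ne_ne_ne₃ {i j l e : Fin N} (hij : i ≠ j) (hil : i ≠ l) (hie : i ≠ e) (hjl : j ≠ l)
    (hje : j ≠ e) (hle : l ≠ e) (a b c : Fin N) : ∃ d, d ≠ a ∧ d ≠ b ∧ d ≠ c := by
  classical
  have h4 : ({i, j, l, e} : Finset (Fin N)).card = 4 := by
    rw [Finset.card_insert_of_notMem (by simp [hij, hil, hie]), Finset.card_insert_of_notMem (by simp [hjl, hje]),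
      Finset.card_pair hle]
  have hcard : ({a, b, c} : Finset (Fin N)).card < ({i, j, l, e} : Finset (Fin N)).card :=
    lt_of_le_of_lt Finset.card_le_three (by rw [h4]; norm_num)
  obtain ⟨d, -, hd⟩ := Finset.exists_mem_notMem_of_card_lt_card hcard
  simp only [Finset.mem_insert, Finset.mem_singleton, not_or] at hd
  exact ⟨d, hd.1, hd.2.1, hd.2.2⟩

/-- A rational `c > M` as a ratio `p/q` of naturals with `Mq < p` (plumbing). [folklore] -/
private theorem exists_ratio_of_lt₇ {M : ℕ} {c : ℚ} (hMc : (M : ℚ) < c) :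
    ∃ p q : ℕ, M * q < p ∧ 1 / c = (q : ℚ) / p := by
  have hc0 : 0 < c := lt_of_le_of_lt (Nat.cast_nonneg M) hMc
  have hnum : 0 < c.num := Rat.num_pos.2 hc0
  have hp : ((c.num.toNat : ℕ) : ℚ) = (c.num : ℚ) := by exact_mod_cast Int.toNat_of_nonneg hnum.le
  have key : c * c.den = c.num := Rat.mul_den_eq_num c
  refine ⟨c.num.toNat, c.den, ?_, ?_⟩
  · have h : (M : ℚ) * c.den < c * c.den := mul_lt_mul_of_pos_right hMc (by exact_mod_cast c.den_pos)
    rw [key, ← hp] at h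
    exact_mod_cast h
  · rw [hp, div_eq_div_iff hc0.ne' (by exact_mod_cast hnum.ne'), one_mul, mul_comm]
    exact key.symm

/-- **Second vertex, invariant form**: no centre for `X_i² + X_j^m X_l + X_{e₁} X_{e₂}` has invariant
`(2, 2, 2, t…)` with `(m+1, m+1) <_trunc t` — i.e. `t = ()`, or `t = (c₄, …)` with `c₄ > m+1`, or
`t = (m+1)`, or `t = (m+1, c₅, …)` with `c₅ > m+1` (`m ≥ 2`; `2 ≠ 0` in `k` or `m` even; ALL polynomial
coordinate changes). (derived here)
[cite: AbramovichTemkinWlodarczyk2024, Thm. 5.3.1 (2) (p. 1578); Temkin2025, §1.2.2 (1) (p. 4)] -/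
theorem not_isCentreFor_umbrellaQuad_of_exps (hij : i ≠ j) (hil : i ≠ l) (hi₁ : i ≠ e₁) (hi₂ : i ≠ e₂)
    (hjl : j ≠ l) (hj₁ : j ≠ e₁) (hj₂ : j ≠ e₂) (hl₁ : l ≠ e₁) (hl₂ : l ≠ e₂) (h₁₂ : e₁ ≠ e₂) (hm : 2 ≤ m)
    (hchar2 : (2 : k) ≠ 0 ∨ Even m)
    {Ψ : MvPolynomial (Fin N) k ≃ₐ[k] MvPolynomial (Fin N) k} {γ : Fin N → ℚ} {t : List ℚ}
    (hexps : exps γ = (2 : ℚ) :: 2 :: 2 :: t)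
    (ht : ATW.TruncLex.lt [((m + 1 : ℕ) : ℚ), ((m + 1 : ℕ) : ℚ)] t) :
    ¬ IsCentreFor (umbrellaQuad k i j l e₁ e₂ m) Ψ γ := by
  classical
  intro hc
  have hM0 : (0 : ℚ) < ((m + 1 : ℕ) : ℚ) := by positivity
  have hsorted : ((2 : ℚ) :: 2 :: 2 :: t).Pairwise (· ≤ ·) := hexps ▸ exps_sorted γ
  have hts : t.Pairwise (· ≤ ·) :=
    (List.pairwise_cons.1 (List.pairwise_cons.1 (List.pairwise_cons.1 hsorted).2).2).2
  -- peel `a₁, a₂, a₃`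
  obtain ⟨a₁, -, hγa₁, ht₁⟩ := exists_update_of_exps_eq_cons hexps
  obtain ⟨a₂, hγa₂0, hγa₂, ht₂⟩ := exists_update_of_exps_eq_cons ht₁
  have h₂₁ : a₂ ≠ a₁ := by rintro rfl; rw [Function.update_self] at hγa₂0; exact hγa₂0 rfl
  rw [Function.update_of_ne h₂₁] at hγa₂
  obtain ⟨a₃, hγa₃0, hγa₃, ht₃⟩ := exists_update_of_exps_eq_cons ht₂
  have h₃₂ : a₃ ≠ a₂ := by rintro rfl; rw [Function.update_self] at hγa₃0; exact hγa₃0 rfl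
  have h₃₁ : a₃ ≠ a₁ := by
    rintro rfl; rw [Function.update_of_ne h₃₂, Function.update_self] at hγa₃0; exact hγa₃0 rfl
  rw [Function.update_of_ne h₃₂, Function.update_of_ne h₃₁] at hγa₃
  set γ₃ := Function.update (Function.update (Function.update γ a₁ 0) a₂ 0) a₃ 0 with hγ₃
  have hγ₃eq : ∀ x, x ≠ a₁ → x ≠ a₂ → x ≠ a₃ → γ₃ x = γ x := fun x h1 h2 h3 => by
    rw [hγ₃, Function.update_of_ne h3, Function.update_of_ne h2, Function.update_of_ne h1]
  have hγ₃a₁ : γ₃ a₁ = 0 := by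
    rw [hγ₃, Function.update_of_ne (Ne.symm h₃₁), Function.update_of_ne (Ne.symm h₂₁), Function.update_self]
  have hγ₃a₂ : γ₃ a₂ = 0 := by rw [hγ₃, Function.update_of_ne (Ne.symm h₃₂), Function.update_self]
  have hγ₃a₃ : γ₃ a₃ = 0 := by rw [hγ₃, Function.update_self]
  have hγ₃nn : ∀ x, 0 ≤ γ₃ x := update_nonneg₇ (update_nonneg₇ (update_nonneg₇ hc.2.1 a₁) a₂) a₃
  have hγa₁' : γ a₁ = 1 / 2 := by rw [hγa₁, one_div]
  have hγa₂' : γ a₂ = 1 / 2 := by rw [hγa₂, one_div]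
  have hγa₃' : γ a₃ = 1 / 2 := by rw [hγa₃, one_div]
  -- it suffices to produce the weight data of the core lemma
  suffices key : ∃ d, d ≠ a₁ ∧ d ≠ a₂ ∧ d ≠ a₃ ∧ γ d ≤ 1 / ((m + 1 : ℕ) : ℚ) ∧
      ∃ c, ((m + 1 : ℕ) : ℚ) < c ∧ ∀ x, x ≠ a₁ → x ≠ a₂ → x ≠ a₃ → x ≠ d → γ x ≤ 1 / c by
    obtain ⟨d, hd₁, hd₂, hd₃, hγd, c, hMc, hE⟩ := key
    obtain ⟨p, q, hpq, hcq⟩ := exists_ratio_of_lt₇ hMc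
    exact not_isCentreFor_umbrellaQuad_vertex hij hil hi₁ hi₂ hjl hj₁ hj₂ hl₁ hl₂ h₁₂ hm hchar2 hγa₁' hγa₂'
      hγa₃' hd₁ hd₂ hd₃ hγd hpq (fun x h1 h2 h3 hxd => hcq ▸ hE x h1 h2 h3 hxd) hc
  have hzero : ∀ {δ : Fin N → ℚ}, exps δ = [] → ∀ x, δ x = 0 := by
    intro δ hδ x
    by_contra hx
    have := inv_mem_exps_of_ne_zero₇ hx
    rw [hδ] at this
    simp at this
  rcases t with _ | ⟨c₄, t'⟩
  · -- `t = ()`: all other weights vanish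
    obtain ⟨d, hd₁, hd₂, hd₃⟩ := exists_ne_ne_ne₃ hij hil hi₁ hjl hj₁ hl₁ a₁ a₂ a₃
    have hz : ∀ x, x ≠ a₁ → x ≠ a₂ → x ≠ a₃ → γ x = 0 := fun x h1 h2 h3 => by
      rw [← hγ₃eq x h1 h2 h3]; exact hzero ht₃ x
    refine ⟨d, hd₁, hd₂, hd₃, by rw [hz d hd₁ hd₂ hd₃]; positivity, ((m + 1 : ℕ) : ℚ) + 1, lt_add_one _,
      fun x h1 h2 h3 _ => by rw [hz x h1 h2 h3]; positivity⟩
  · rw [ATW.TruncLex.cons_lt_cons] at ht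
    rcases ht with hlt | ⟨heq, ht'⟩
    · -- `c₄ > m + 1`
      obtain ⟨d, hd₁, hd₂, hd₃⟩ := exists_ne_ne_ne₃ hij hil hi₁ hjl hj₁ hl₁ a₁ a₂ a₃
      have hbound : ∀ x, x ≠ a₁ → x ≠ a₂ → x ≠ a₃ → γ x ≤ 1 / c₄ := fun x h1 h2 h3 => by
        rw [← hγ₃eq x h1 h2 h3]
        exact le_inv_of_exps_eq ht₃ (hM0.trans hlt) (fun y hy => le_of_mem_of_pairwise₇ hts hy) hγ₃nn x
      exact ⟨d, hd₁, hd₂, hd₃, (hbound d hd₁ hd₂ hd₃).trans (one_div_le_one_div_of_le hM0 hlt.le), c₄, hlt,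
        fun x h1 h2 h3 _ => hbound x h1 h2 h3⟩
    · -- `c₄ = m + 1`: peel `d`
      subst heq
      obtain ⟨d, hγd0, hγd, htd⟩ := exists_update_of_exps_eq_cons ht₃
      have hd₁ : d ≠ a₁ := by rintro rfl; exact hγd0 hγ₃a₁
      have hd₂ : d ≠ a₂ := by rintro rfl; exact hγd0 hγ₃a₂
      have hd₃ : d ≠ a₃ := by rintro rfl; exact hγd0 hγ₃a₃
      have hγd' : γ d = 1 / ((m + 1 : ℕ) : ℚ) := by rw [← hγ₃eq d hd₁ hd₂ hd₃, hγd, one_div]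
      have hγ₄eq : ∀ x, x ≠ a₁ → x ≠ a₂ → x ≠ a₃ → x ≠ d → Function.update γ₃ d 0 x = γ x :=
        fun x h1 h2 h3 hxd => by rw [Function.update_of_ne hxd, hγ₃eq x h1 h2 h3]
      have hγ₄nn : ∀ x, 0 ≤ Function.update γ₃ d 0 x := update_nonneg₇ hγ₃nn d
      rcases t' with _ | ⟨c₅, t''⟩
      · -- `t = (m+1)`
        refine ⟨d, hd₁, hd₂, hd₃, hγd'.le, ((m + 1 : ℕ) : ℚ) + 1, lt_add_one _, fun x h1 h2 h3 hxd => ?_⟩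
        rw [← hγ₄eq x h1 h2 h3 hxd, hzero htd x]
        positivity
      · rw [ATW.TruncLex.cons_lt_cons] at ht'
        rcases ht' with hlt5 | ⟨-, hnil⟩
        · -- `t = (m+1, c₅, …)` with `c₅ > m+1`
          have hts' : (c₅ :: t'').Pairwise (· ≤ ·) := (List.pairwise_cons.1 hts).2
          refine ⟨d, hd₁, hd₂, hd₃, hγd'.le, c₅, hlt5, fun x h1 h2 h3 hxd => ?_⟩
          rw [← hγ₄eq x h1 h2 h3 hxd]
          exact le_inv_of_exps_eq htd (hM0.trans hlt5) (fun y hy => le_of_mem_of_pairwise₇ hts' hy) hγ₄nn x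
        · exact (ATW.TruncLex.not_nil_lt _ hnil).elim

/-- **`max W(X_i² + X_j^m X_l + X_{e₁} X_{e₂}) = (2, 2, 2, m+1, m+1)`** in the cell's polynomial
weighted-centre model (`i, j, l, e₁, e₂` distinct, any number of spectator variables, `m ≥ 2`, ALL polynomial
coordinate changes; `2 ≠ 0` in `k` or `m` even): the invariant `(2, 2, 2, m+1, m+1)` of the coordinate centre
`(X_i², X_{e₁}², X_{e₂}², X_j^{m+1}, X_l^{m+1})` is attained and nothing in `W` exceeds it in the
truncated-lexicographic order. (derived here) Instrument of the Resolution Observatory — NOT a resolution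
theorem. [cite: AbramovichTemkinWlodarczyk2024, Thm. 5.3.1 (2) (p. 1578) (inv_p = max over admissible
centres); CossartJannsenSaito2020, Thm. 8.16 (p. 121); Temkin2025, §1.2.2 (1) (p. 4)] -/
theorem isMaxInv_umbrellaQuad (hij : i ≠ j) (hil : i ≠ l) (hi₁ : i ≠ e₁) (hi₂ : i ≠ e₂) (hjl : j ≠ l)
    (hj₁ : j ≠ e₁) (hj₂ : j ≠ e₂) (hl₁ : l ≠ e₁) (hl₂ : l ≠ e₂) (h₁₂ : e₁ ≠ e₂) (hm : 2 ≤ m)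
    (hchar2 : (2 : k) ≠ 0 ∨ Even m) :
    IsMaxInv (admissibleInvariants (umbrellaQuad k i j l e₁ e₂ m))
      [(2 : ℚ), 2, 2, ((m + 1 : ℕ) : ℚ), ((m + 1 : ℕ) : ℚ)] := by
  refine ⟨umbrellaQuad_inv_mem hij hil hi₁ hi₂ hjl hj₁ hj₂ hl₁ hl₂ h₁₂ (by omega), fun b hb => ?_⟩
  have hff := not_lt_of_mem_admissibleInvariants_umbrellaQuad hil hi₁ hi₂ hjl h₁₂ hm hb
  obtain ⟨Ψ, γ, hc, rfl⟩ := hb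
  rcases hγ : exps γ with _ | ⟨b₁, _ | ⟨b₂, _ | ⟨b₃, t⟩⟩⟩
  · rw [hγ] at hff
    exact (hff (ATW.TruncLex.cons_lt_nil _ _)).elim
  · rw [hγ] at hff
    intro h
    rw [ATW.TruncLex.cons_lt_cons] at h hff
    exact hff (h.imp id fun h2 => ⟨h2.1, ATW.TruncLex.cons_lt_nil _ _⟩)
  · rw [hγ] at hff
    intro h
    rw [ATW.TruncLex.cons_lt_cons, ATW.TruncLex.cons_lt_cons] at h hff
    exact hff (h.imp id fun h2 => ⟨h2.1, h2.2.imp id fun h3 => ⟨h3.1, ATW.TruncLex.cons_lt_nil _ _⟩⟩)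
  · rw [hγ] at hff
    intro h
    rw [ATW.TruncLex.cons_lt_cons, ATW.TruncLex.cons_lt_cons, ATW.TruncLex.cons_lt_cons] at h hff
    rcases h with h1 | ⟨h1, h2 | ⟨h2, h3 | ⟨h3, h4⟩⟩⟩
    · exact hff (Or.inl h1)
    · exact hff (Or.inr ⟨h1, Or.inl h2⟩)
    · exact hff (Or.inr ⟨h1, Or.inr ⟨h2, Or.inl h3⟩⟩)
    · subst h1 h2 h3
      exact not_isCentreFor_umbrellaQuad_of_exps hij hil hi₁ hi₂ hjl hj₁ hj₂ hl₁ hl₂ h₁₂ hm hchar2 hγ h4 hc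

/-- **Census shape `v² + w⁴ u + y z` (`U22ZZ`): `max W = (2, 2, 2, 5, 5)` in EVERY characteristic**
(`m = 4` is even), for all polynomial coordinate changes and any number of spectators. (derived here)
Instrument — NOT a resolution theorem. [cite: AbramovichTemkinWlodarczyk2024, Thm. 5.3.1 (2) (p. 1578);
Temkin2025, §1.2.2 (1) (p. 4)] -/
theorem isMaxInv_umbrellaQuad_four (hij : i ≠ j) (hil : i ≠ l) (hi₁ : i ≠ e₁) (hi₂ : i ≠ e₂) (hjl : j ≠ l)
    (hj₁ : j ≠ e₁) (hj₂ : j ≠ e₂) (hl₁ : l ≠ e₁) (hl₂ : l ≠ e₂) (h₁₂ : e₁ ≠ e₂) :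
    IsMaxInv (admissibleInvariants (umbrellaQuad k i j l e₁ e₂ 4)) [(2 : ℚ), 2, 2, 5, 5] := by
  have h := isMaxInv_umbrellaQuad (k := k) hij hil hi₁ hi₂ hjl hj₁ hj₂ hl₁ hl₂ h₁₂ (by norm_num : 2 ≤ 4)
    (Or.inr (by decide))
  norm_num at h
  exact h

/-- **Census shape `v² + w² u + y z`: `max W = (2, 2, 2, 3, 3)` in EVERY characteristic** (`m = 2` is
even), for all polynomial coordinate changes and any number of spectators. (derived here) Instrument — NOT a
resolution theorem. [cite: AbramovichTemkinWlodarczyk2024, Thm. 5.3.1 (2) (p. 1578); Temkin2025, §1.2.2 (1)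
(p. 4)] -/
theorem isMaxInv_umbrellaQuad_two (hij : i ≠ j) (hil : i ≠ l) (hi₁ : i ≠ e₁) (hi₂ : i ≠ e₂) (hjl : j ≠ l)
    (hj₁ : j ≠ e₁) (hj₂ : j ≠ e₂) (hl₁ : l ≠ e₁) (hl₂ : l ≠ e₂) (h₁₂ : e₁ ≠ e₂) :
    IsMaxInv (admissibleInvariants (umbrellaQuad k i j l e₁ e₂ 2)) [(2 : ℚ), 2, 2, 3, 3] := by
  have h := isMaxInv_umbrellaQuad (k := k) hij hil hi₁ hi₂ hjl hj₁ hj₂ hl₁ hl₂ h₁₂ (le_refl 2)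
    (Or.inr (by decide))
  norm_num at h
  exact h

end Assembly

end Literature.AlgebraicGeometry.Resolution.WeightedBlowup
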